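import Literature.Barriers.CriticalPhenomena.PositionSpaceRGNonGibbsianPeierlsCondition
import HarnessLib

/-!
# Barrier `PositionSpaceRGNonGibbsian`, Theorem 4.3 for spacings `b ≥ 3`: the flip∘shift
# symmetry of the internal-spin system and the energy released by erasing a contour

Companion file on the Theorem 4.3 line of
`Literature/Barriers/CriticalPhenomena/PositionSpaceRGNonGibbsian.lean` (van Enter–Fernández–Sokal,
J. Stat. Phys. **72** (1993) 879, arXiv:hep-lat/9210032, §4.3.2 and App. B.5.3). For the fully
alternating image spins `p·ω'_alt` of §4.3.2 the internal-spin system ("an Ising model on a periodic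
lattice … with a periodic alternating magnetic field", §4.3.2) is invariant under the composition of
the global spin flip with the translation by `b e₁` (which flips every image spin, App. B.5.3:
"the configurations `ω^{(+)}` and `ω^{(-)}`" are the two ground states exchanged by it). This file
proves the two finite-volume energy identities through which that symmetry enters the Peierls
argument of `…Thm43Peierls.lean` (replacing the Pirogov–Sinai analysis of the source):

* `flipShift I φ σ` — the configuration `σ` with the spins on the set `I` replaced by the flipped
  spins read off at the translated sites `φ u` (`φ` the translation by a period);
* **Lemma A** (`fieldHamiltonian_flipShift_sub`): if the field is anti-periodic under `φ` on `I`
  (`h(φ u) = -h(u)`) and the configuration is constant (`= t`) on the band of `I` not covered by both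
  `I` and `φ(I)`, and locally constant across the boundary bonds of `I`, then
  `ℋ(flipShift I φ σ) - ℋ(σ) = 2·#∂ᵉI + 2t·∑_{u ∈ I} h_u` — the bulk terms cancel exactly by the
  symmetry, only the boundary bonds of `I` and the (anti-periodic, hence boundary-like) field sum
  survive;
* **Lemma B** (`fieldHamiltonian_sub_flipOn_of_const`): flipping a set `N` on which the
  configuration is `u` while all internal neighbours outside `N` carry `-u` releases
  `ℋ(σ) - ℋ(σ^N) = 2·#ffBdryPairs N - 2u·∑_{y ∈ N} h_y`;
* the combination (`fieldHamiltonian_sub_erase`): erasing a contour = flip∘shift on the oppositely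
  labelled interior `I` followed by the flip of the contour sites `N` of the wrong sign releases
  `2·#ffBdryPairs(N ∪ I) - 2t·∑_{N ∪ I} h`, the relative energy (B.71) of the island `N ∪ I` in the
  ground state `t` (`card_ffBdryPairs_eq_add` does the bookkeeping of boundary pairs), which the
  tree's Peierls condition bounds below by the area `#ffBdryPairs(N ∪ I)`
  (`card_ffBdryPairs_le_of_peierls`).

Nothing is asserted: the file is sorry-free and introduces no named fact (D-0014, D-0026).

## References

* A. C. D. van Enter, R. Fernández, A. D. Sokal, J. Stat. Phys. 72 (1993) 879–1167,
  arXiv:hep-lat/9210032 — §4.3.2 and App. B.5.3 [VanenterFernandezSokal1993].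
* S. Friedli, Y. Velenik, *Statistical Mechanics of Lattice Systems*, CUP 2017, §3.8.1 eq. (3.51)
  and Lemma 3.36 [FriedliVelenik2017].
-/

noncomputable section

namespace Literature.Barriers.CriticalPhenomena.NonGibbs

open Finset Literature.Probability.LatticeModels

variable {d : ℕ}

/-! ### The flip∘shift on a set of sites -/

/-- **Flip∘shift on `I`**: the spins on `I` are replaced by the flipped spins of `σ` read off at the
translated sites `φ u`; off `I` nothing changes. For the internal-spin system with fully alternating
image spins and `φ` the translation by a period `b e₁`, this is the restriction to `I` of the exact
symmetry "global flip ∘ translation" exchanging the two ground states `ω^{(+)}`, `ω^{(-)}`.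
[cite: VanenterFernandezSokal1993, §4.3.2 and App. B.5.3 (the two periodic ground states)] -/
def flipShift (I : Finset (Site d)) (φ : Site d → Site d) (σ : SpinConfig (Site d)) : SpinConfig (Site d) :=
  fun u => if u ∈ I then -σ (φ u) else σ u

/-- `flipShift` on `I`. [cite: VanenterFernandezSokal1993, App. B.5.3] -/
theorem flipShift_of_mem {I : Finset (Site d)} (φ : Site d → Site d) (σ : SpinConfig (Site d)) {u : Site d}
    (hu : u ∈ I) : flipShift I φ σ u = -σ (φ u) := by
  simp [flipShift, hu]

/-- `flipShift` off `I`. [cite: VanenterFernandezSokal1993, App. B.5.3] -/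
theorem flipShift_of_notMem {I : Finset (Site d)} (φ : Site d → Site d) (σ : SpinConfig (Site d)) {u : Site d}
    (hu : u ∉ I) : flipShift I φ σ u = σ u := by
  simp [flipShift, hu]

/-- The spin of `flipShift` on `I`. [cite: VanenterFernandezSokal1993, App. B.5.3] -/
theorem spinAt_flipShift_of_mem {I : Finset (Site d)} (φ : Site d → Site d) (σ : SpinConfig (Site d))
    {u : Site d} (hu : u ∈ I) : spinAt u (flipShift I φ σ) = -spinAt (φ u) σ := by
  simp [spinAt, flipShift_of_mem φ σ hu]

/-- The spin of `flipShift` off `I`. [cite: VanenterFernandezSokal1993, App. B.5.3] -/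
theorem spinAt_flipShift_of_notMem {I : Finset (Site d)} (φ : Site d → Site d) (σ : SpinConfig (Site d))
    {u : Site d} (hu : u ∉ I) : spinAt u (flipShift I φ σ) = spinAt u σ := by
  simp [spinAt, flipShift_of_notMem φ σ hu]

/-- Equal spins have product `1`. [folklore] -/
theorem spinAt_mul_spinAt_of_eq {x y : Site d} {σ : SpinConfig (Site d)} (h : σ x = σ y) :
    spinAt x σ * spinAt y σ = 1 := by
  have : spinAt x σ = spinAt y σ := by simp [spinAt, h]
  rw [this, spinAt_mul_self]

/-! ### Translating internal bonds by a period -/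

section Translate

variable {b : ℕ}

/-- The internal bonds with both endpoints in `I`, translated by the period `b z`, are the internal
bonds with both endpoints in the translate of `I`. [cite: VanenterFernandezSokal1993, §4.3.2 ("periodic lattice")] -/
theorem image_map_spShift_edgesIn (z : Site d) (I : Finset (Site d)) :
    (edgesIn (spDilutedGraph d b) I).image (Sym2.map (spShift d b z)) =
      edgesIn (spDilutedGraph d b) (I.image (spShift d b z)) := by
  classical
  ext e'
  rw [mem_image, mem_edgesIn_iff]
  constructor
  · rintro ⟨e, he, rfl⟩
    rw [mem_edgesIn_iff] at he
    obtain ⟨heE, heI⟩ := he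
    induction e using Sym2.ind with
    | _ x y =>
      rw [Sym2.map_mk]
      refine ⟨?_, fun w hw => ?_⟩
      · rw [SimpleGraph.mem_edgeSet, spDilutedGraph_adj_spShift]
        exact (SimpleGraph.mem_edgeSet _).1 heE
      · rcases Sym2.mem_iff.1 hw with rfl | rfl
        · exact mem_image_of_mem _ (heI x (Sym2.mem_mk_left x y))
        · exact mem_image_of_mem _ (heI y (Sym2.mem_mk_right x y))
  · rintro ⟨heE, heJ⟩
    induction e' using Sym2.ind with
    | _ a c =>
      obtain ⟨x, hx, rfl⟩ := mem_image.1 (heJ a (Sym2.mem_mk_left a c))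
      obtain ⟨y, hy, rfl⟩ := mem_image.1 (heJ _ (Sym2.mem_mk_right _ c))
      refine ⟨s(x, y), mem_edgesIn_iff.2 ⟨?_, fun w hw => ?_⟩, by rw [Sym2.map_mk]⟩
      · rw [SimpleGraph.mem_edgeSet, ← spDilutedGraph_adj_spShift b z]
        exact (SimpleGraph.mem_edgeSet _).1 heE
      · rcases Sym2.mem_iff.1 hw with rfl | rfl
        · exact hx
        · exact hy

/-- Translation of bonds is injective. [folklore] -/
theorem map_spShift_injective (z : Site d) : Function.Injective (Sym2.map (spShift d b z)) :=
  Sym2.map.injective (spShift d b z).injective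

/-- The numbers of internal bonds inside `I` and inside its translate agree.
[cite: VanenterFernandezSokal1993, §4.3.2 ("periodic lattice")] -/
theorem card_edgesIn_image_spShift (z : Site d) (I : Finset (Site d)) :
    #(edgesIn (spDilutedGraph d b) (I.image (spShift d b z))) = #(edgesIn (spDilutedGraph d b) I) := by
  classical
  rw [← image_map_spShift_edgesIn z I, card_image_of_injective _ (map_spShift_injective z)]

end Translate

/-! ### Lemma A: the energy change under flip∘shift -/

section LemmaA

variable {b : ℕ}

/-- **Lemma A (flip∘shift with constant bands).** Let `φ` be the translation by a period `b z`,
`I ⊆ Λ`, and let the field be anti-periodic on `I` (`h(φ u) = -h u`). Suppose the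
configuration `σ` equals `t` on the band `φ(I) ∖ I` and on `I ∖ φ(I)`, is locally constant on the
internal bonds inside `I` not inside `φ(I)` and inside `φ(I)` not inside `I`, and across every
boundary bond `{x, y}` of `I` (`x ∈ I`, `y ∉ I`) satisfies `σ(φ x) = σ x = σ y`. Then
`ℋ(flipShift I φ σ) - ℋ(σ) = 2·#∂ᵉI + 2t·∑_{u ∈ I} h_u`: inside `I` the bonds and fields of the
flip-shifted configuration are those of `σ` inside `φ(I)` (the symmetry), and the difference of the
two bulk sums is a band sum on which `σ` is constant. (Field Hamiltonian of the `b`-diluted graph,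
Friedli–Velenik eq. (3.51); the boundary condition enters only through the bond set.)
[cite: VanenterFernandezSokal1993, App. B.5.3; FriedliVelenik2017, §3.8.1 eq. (3.51)] -/
theorem fieldHamiltonian_flipShift_sub (z : Site d) {Λ I : Finset (Site d)} (hIΛ : I ⊆ Λ) (h : Site d → ℝ)
    (hALT : ∀ x ∈ I, h (spShift d b z x) = -h x) {σ : SpinConfig (Site d)} {t : ℤˣ}
    (hB1 : ∀ x ∈ I, spShift d b z x ∉ I → σ (spShift d b z x) = t)
    (hB2 : ∀ x ∈ I, x ∉ I.image (spShift d b z) → σ x = t)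
    (hBA : ∀ x ∈ I, ∀ y ∈ I, (spDilutedGraph d b).Adj x y →
      (x ∉ I.image (spShift d b z) ∨ y ∉ I.image (spShift d b z)) → σ x = σ y)
    (hBB : ∀ x ∈ I, ∀ y ∈ I, (spDilutedGraph d b).Adj x y →
      (spShift d b z x ∉ I ∨ spShift d b z y ∉ I) → σ (spShift d b z x) = σ (spShift d b z y))
    (hC : ∀ x ∈ I, ∀ y ∉ I, (spDilutedGraph d b).Adj x y → σ (spShift d b z x) = σ x ∧ σ y = σ x)
    (η : SpinConfig (Site d)) :
    fieldHamiltonian (spDilutedGraph d b) Λ h (.fixed η) (flipShift I (spShift d b z) σ) -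
        fieldHamiltonian (spDilutedGraph d b) Λ h (.fixed η) σ =
      2 * #(edgeBoundary (spDilutedGraph d b) I) + 2 * ((t : ℤ) : ℝ) * ∑ x ∈ I, h x := by
  classical
  set G := spDilutedGraph d b with hG
  set φ := spShift d b z with hφ
  set J := I.image φ with hJ
  set FS := flipShift I φ σ with hFS
  have hφinj : Function.Injective φ := (spShift d b z).injective
  -- (i) boundary bonds of `I`: each contributes `-2`
  have hbdry : ∑ e ∈ edgeBoundary G I, (bondSpin FS e - bondSpin σ e) = -2 * #(edgeBoundary G I) := by
    rw [card_eq_sum_ones, Nat.cast_sum, Nat.cast_one, mul_sum]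
    refine sum_congr rfl fun e he => ?_
    rw [mem_edgeBoundary_iff] at he
    obtain ⟨heG, ⟨x, hx, hxe⟩, ⟨y, hy, hye⟩⟩ := he
    have hxy : x ≠ y := fun h' => hy (h' ▸ hx)
    have hexy : e = s(x, y) := (Sym2.mem_and_mem_iff hxy).1 ⟨hxe, hye⟩
    subst hexy
    have hadj : G.Adj x y := (SimpleGraph.mem_edgeSet G).1 heG
    obtain ⟨h1, h2⟩ := hC x hx y hy hadj
    rw [bondSpin_mk, bondSpin_mk, hFS, spinAt_flipShift_of_mem φ σ hx, spinAt_flipShift_of_notMem φ σ hy]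
    have e1 : spinAt (φ x) σ = spinAt x σ := by rw [spinAt, spinAt, h1]
    have e2 : spinAt y σ = spinAt x σ := by rw [spinAt, spinAt, h2]
    rw [e1, e2]
    have := spinAt_mul_self x σ
    linarith
  -- (ii) bonds inside `I`: the flip-shifted bonds are the bonds of `σ` inside `J`
  have hin : ∑ e ∈ edgesIn G I, bondSpin FS e = ∑ e ∈ edgesIn G J, bondSpin σ e := by
    rw [hJ, ← image_map_spShift_edgesIn z I, sum_image fun e _ e' _ h' => map_spShift_injective z h']
    refine sum_congr rfl fun e he => ?_
    obtain ⟨-, heI⟩ := mem_edgesIn_iff.1 he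
    induction e using Sym2.ind with
    | _ x y =>
      rw [Sym2.map_mk, bondSpin_mk, bondSpin_mk, hFS, spinAt_flipShift_of_mem φ σ (heI x (Sym2.mem_mk_left x y)),
        spinAt_flipShift_of_mem φ σ (heI y (Sym2.mem_mk_right x y))]
      ring
  -- the band bonds carry the value `1`
  have hbandI : ∑ e ∈ edgesIn G I \ edgesIn G J, bondSpin σ e = #(edgesIn G I \ edgesIn G J) := by
    rw [card_eq_sum_ones, Nat.cast_sum, Nat.cast_one]
    refine sum_congr rfl fun e he => ?_
    rw [mem_sdiff, mem_edgesIn_iff, mem_edgesIn_iff, not_and] at he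
    obtain ⟨⟨heG, heI⟩, heJ⟩ := he
    have heJ' : ¬ ∀ w ∈ e, w ∈ J := heJ heG
    induction e using Sym2.ind with
    | _ x y =>
      have hx := heI x (Sym2.mem_mk_left x y)
      have hy := heI y (Sym2.mem_mk_right x y)
      have hor : x ∉ J ∨ y ∉ J := by
        by_contra hcon
        push Not at hcon
        exact heJ' fun w hw => by rcases Sym2.mem_iff.1 hw with rfl | rfl <;> tauto
      rw [bondSpin_mk]
      exact spinAt_mul_spinAt_of_eq (hBA x hx y hy ((SimpleGraph.mem_edgeSet G).1 heG) hor)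
  have hbandJ : ∑ e ∈ edgesIn G J \ edgesIn G I, bondSpin σ e = #(edgesIn G J \ edgesIn G I) := by
    rw [card_eq_sum_ones, Nat.cast_sum, Nat.cast_one]
    refine sum_congr rfl fun e he => ?_
    rw [mem_sdiff, mem_edgesIn_iff, mem_edgesIn_iff, not_and] at he
    obtain ⟨⟨heG, heJ⟩, heI⟩ := he
    have heI' : ¬ ∀ w ∈ e, w ∈ I := heI heG
    induction e using Sym2.ind with
    | _ a c =>
      obtain ⟨x, hx, rfl⟩ := mem_image.1 (heJ a (Sym2.mem_mk_left a c))
      obtain ⟨y, hy, rfl⟩ := mem_image.1 (heJ _ (Sym2.mem_mk_right _ c))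
      have hadj : G.Adj x y := (spDilutedGraph_adj_spShift b z x y).1 ((SimpleGraph.mem_edgeSet G).1 heG)
      have hor : φ x ∉ I ∨ φ y ∉ I := by
        by_contra hcon
        push Not at hcon
        exact heI' fun w hw => by rcases Sym2.mem_iff.1 hw with rfl | rfl <;> tauto
      rw [bondSpin_mk]
      exact spinAt_mul_spinAt_of_eq (hBB x hx y hy hadj hor)
  have hcardIJ : #(edgesIn G I \ edgesIn G J) = #(edgesIn G J \ edgesIn G I) := by
    have h1 := card_sdiff_add_card_inter (edgesIn G I) (edgesIn G J)
    have h2 := card_sdiff_add_card_inter (edgesIn G J) (edgesIn G I)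
    have h3 : #(edgesIn G J) = #(edgesIn G I) := by rw [hJ]; exact card_edgesIn_image_spShift z I
    rw [inter_comm] at h2
    omega
  have hbonds_in : ∑ e ∈ edgesIn G I, bondSpin σ e - ∑ e ∈ edgesIn G J, bondSpin σ e = 0 := by
    rw [← sum_sdiff_sub_sum_sdiff, hbandI, hbandJ, hcardIJ, sub_self]
  -- (iii) fields: on `I` the flip-shifted field energy is the field energy of `σ` on `J`
  have hfieldFS : ∑ x ∈ I, h x * spinAt x FS = ∑ x ∈ J, h x * spinAt x σ := by
    rw [hJ, sum_image fun x _ y _ h' => hφinj h']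
    refine sum_congr rfl fun x hx => ?_
    rw [hFS, spinAt_flipShift_of_mem φ σ hx, hALT x hx]
    ring
  have hfield_band : ∑ x ∈ I, h x * spinAt x σ - ∑ x ∈ J, h x * spinAt x σ = 2 * ((t : ℤ) : ℝ) * ∑ x ∈ I, h x := by
    rw [← sum_sdiff_sub_sum_sdiff]
    have hI : ∑ x ∈ I \ J, h x * spinAt x σ = ((t : ℤ) : ℝ) * ∑ x ∈ I \ J, h x := by
      rw [mul_sum]
      refine sum_congr rfl fun x hx => ?_
      obtain ⟨hxI, hxJ⟩ := mem_sdiff.1 hx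
      rw [spinAt, hB2 x hxI hxJ]; ring
    have hJ' : ∑ x ∈ J \ I, h x * spinAt x σ = ((t : ℤ) : ℝ) * ∑ x ∈ J \ I, h x := by
      rw [mul_sum]
      refine sum_congr rfl fun w hw => ?_
      obtain ⟨hwJ, hwI⟩ := mem_sdiff.1 hw
      obtain ⟨x, hx, rfl⟩ := mem_image.1 hwJ
      rw [spinAt, hB1 x hx hwI]; ring
    have hsumJ : ∑ x ∈ J, h x = -∑ x ∈ I, h x := by
      rw [hJ, sum_image fun x _ y _ h' => hφinj h', ← sum_neg_distrib]
      exact sum_congr rfl fun x hx => hALT x hx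
    rw [hI, hJ', ← mul_sub, sum_sdiff_sub_sum_sdiff, hsumJ]
    ring
  -- assemble: reduce the sums over `Λ` to `I`, split the bonds touching `I`
  have htouch : ∑ e ∈ edgesTouching G Λ, (bondSpin FS e - bondSpin σ e) =
      ∑ e ∈ edgesTouching G I, (bondSpin FS e - bondSpin σ e) := by
    refine (sum_subset (edgesTouching_mono G hIΛ) fun e he hne => ?_).symm
    rw [mem_edgesTouching_iff] at he
    rw [mem_edgesTouching_iff, not_and] at hne
    have hne' := hne he.1
    push Not at hne'
    induction e using Sym2.ind with
    | _ x y =>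
      rw [bondSpin_mk, bondSpin_mk, hFS,
        spinAt_flipShift_of_notMem φ σ (fun hxI => hne' x hxI (Sym2.mem_mk_left x y)),
        spinAt_flipShift_of_notMem φ σ (fun hyI => hne' y hyI (Sym2.mem_mk_right x y)), sub_self]
  have hsplit : ∑ e ∈ edgesTouching G I, (bondSpin FS e - bondSpin σ e) =
      ∑ e ∈ edgeBoundary G I, (bondSpin FS e - bondSpin σ e) +
        ∑ e ∈ edgesIn G I, (bondSpin FS e - bondSpin σ e) := by
    rw [← sum_sdiff (edgesIn_subset_edgesTouching (G := G) I)]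
    rfl
  have hsites : ∑ x ∈ Λ, (h x * spinAt x FS - h x * spinAt x σ) = ∑ x ∈ I, (h x * spinAt x FS - h x * spinAt x σ) := by
    refine (sum_subset hIΛ fun x _ hxI => ?_).symm
    rw [hFS, spinAt_flipShift_of_notMem φ σ hxI, sub_self]
  have key : fieldHamiltonian G Λ h (.fixed η) FS - fieldHamiltonian G Λ h (.fixed η) σ =
      -(∑ e ∈ edgesTouching G Λ, (bondSpin FS e - bondSpin σ e)) -
        ∑ x ∈ Λ, (h x * spinAt x FS - h x * spinAt x σ) := by
    simp only [fieldHamiltonian, interactionEdges_fixed, sum_sub_distrib]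
    ring
  rw [key, htouch, hsplit, hsites, hbdry, sum_sub_distrib, sum_sub_distrib, hin, hfieldFS]
  linear_combination hbonds_in + hfield_band

end LemmaA

/-! ### Lemma B: flipping a set on which the configuration and its internal neighbours are known -/

section LemmaB

variable {b : ℕ}

/-- **The energy released by flipping `N ⊆ Λ`** for the field Hamiltonian (Friedli–Velenik,
proof of Lemma 3.36, eq. (3.37), with a site-dependent field): only the boundary bonds of `N` and
the field on `N` change. [cite: FriedliVelenik2017, Lemma 3.36] -/
theorem fieldHamiltonian_sub_fieldHamiltonian_flipOn {W : Type*} [DecidableEq W] (G' : SimpleGraph W)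
    [G'.LocallyFinite] {Λ N : Finset W} (hN : N ⊆ Λ) (h : W → ℝ) (η σ : SpinConfig W) :
    fieldHamiltonian G' Λ h (.fixed η) σ - fieldHamiltonian G' Λ h (.fixed η) (flipOn N σ) =
      -2 * (∑ e ∈ edgeBoundary G' N, bondSpin σ e) - 2 * ∑ x ∈ N, h x * spinAt x σ := by
  have hbonds : ∑ e ∈ edgesTouching G' Λ, bondSpin (flipOn N σ) e -
      ∑ e ∈ edgesTouching G' Λ, bondSpin σ e = -2 * ∑ e ∈ edgeBoundary G' N, bondSpin σ e := by
    rw [← Finset.sum_sub_distrib, Finset.mul_sum,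
      ← Finset.sum_subset (edgeBoundary_subset_edgesTouching G' hN)]
    · refine Finset.sum_congr rfl fun e he => ?_
      rw [bondSpin_flipOn_of_mem_edgeBoundary G' σ he]; ring
    · intro e he hne
      rw [bondSpin_flipOn_of_not_mem_edgeBoundary G' σ he hne, sub_self]
  have hfield : ∑ x ∈ Λ, h x * spinAt x (flipOn N σ) - ∑ x ∈ Λ, h x * spinAt x σ =
      -2 * ∑ x ∈ N, h x * spinAt x σ := by
    rw [← Finset.sum_sub_distrib, Finset.mul_sum, ← Finset.sum_subset hN]
    · refine Finset.sum_congr rfl fun x hx => ?_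
      rw [spinAt_flipOn_of_mem σ hx]; ring
    · intro x _ hxN
      rw [spinAt_flipOn_of_notMem σ hxN, sub_self]
  simp only [fieldHamiltonian, interactionEdges_fixed]
  linear_combination hbonds + hfield

/-- In the `b`-diluted graph the neighbours of an internal site outside `M` are its internal
`ℤ^d`-neighbours outside `M`. [cite: VanenterFernandezSokal1993, §4.3.1 Step 2.2] -/
theorem outNbrs_spDilutedGraph {M : Finset (Site d)} {y : Site d} (hy : ¬ IsSpImageSite d b y) :
    outNbrs (spDilutedGraph d b) M y = (outNbrs (zdGraph d) M y).filter fun w => ¬ IsSpImageSite d b w := by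
  ext w
  simp only [mem_outNbrs, mem_filter, spDilutedGraph_adj]
  tauto

/-- **`#ffBdryPairs` via the diluted graph**: for a set `M` of internal sites,
`#ffBdryPairs M = ∑_{y ∈ M} #{internal neighbours of y outside M}`.
[cite: VanenterFernandezSokal1993, App. B.5.3 (p. 236)] -/
theorem card_ffBdryPairs_eq_sum_outNbrs_spDiluted {M : Finset (Site d)} (hM : ∀ y ∈ M, ¬ IsSpImageSite d b y) :
    #(ffBdryPairs d b M) = ∑ y ∈ M, #(outNbrs (spDilutedGraph d b) M y) := by
  rw [card_ffBdryPairs_eq_sum]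
  exact sum_congr rfl fun y hy => by rw [outNbrs_spDilutedGraph (hM y hy)]

/-- **Lemma B (flipping a set with known surroundings).** If `σ ≡ u` on a set `N ⊆ Λ` of internal
sites and every internal neighbour of `N` outside `N` carries `-u`, then flipping `N` releases
`ℋ(σ) - ℋ(σ^N) = 2·#ffBdryPairs N - 2u·∑_{y ∈ N} h_y` (every boundary bond of `N` goes from
frustrated to satisfied). [cite: FriedliVelenik2017, Lemma 3.36; VanenterFernandezSokal1993, App. B.5.3 eq. (B.71)] -/
theorem fieldHamiltonian_sub_flipOn_of_const {Λ N : Finset (Site d)} (hNΛ : N ⊆ Λ)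
    (hNint : ∀ y ∈ N, ¬ IsSpImageSite d b y) (h : Site d → ℝ) {σ : SpinConfig (Site d)} {u : ℤˣ}
    (hN : ∀ y ∈ N, σ y = u) (hout : ∀ y ∈ N, ∀ w ∉ N, (spDilutedGraph d b).Adj y w → σ w = -u)
    (η : SpinConfig (Site d)) :
    fieldHamiltonian (spDilutedGraph d b) Λ h (.fixed η) σ -
        fieldHamiltonian (spDilutedGraph d b) Λ h (.fixed η) (flipOn N σ) =
      2 * #(ffBdryPairs d b N) - 2 * ((u : ℤ) : ℝ) * ∑ y ∈ N, h y := by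
  rw [fieldHamiltonian_sub_fieldHamiltonian_flipOn _ hNΛ, sum_edgeBoundary_bondSpin,
    card_ffBdryPairs_eq_sum_outNbrs_spDiluted hNint, Nat.cast_sum]
  have hu : ∀ y ∈ N, spinAt y σ = ((u : ℤ) : ℝ) := fun y hy => by rw [spinAt, hN y hy]
  have h1 : ∑ y ∈ N, spinAt y σ * ∑ w ∈ outNbrs (spDilutedGraph d b) N y, spinAt w σ =
      -∑ y ∈ N, (#(outNbrs (spDilutedGraph d b) N y) : ℝ) := by
    rw [← sum_neg_distrib]
    refine sum_congr rfl fun y hy => ?_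
    have hw : ∀ w ∈ outNbrs (spDilutedGraph d b) N y, spinAt w σ = -((u : ℤ) : ℝ) := fun w hw => by
      obtain ⟨hadj, hwN⟩ := (mem_outNbrs _).1 hw
      rw [spinAt, hout y hy w hwN hadj, Units.val_neg, Int.cast_neg]
    rw [sum_congr rfl hw, sum_const, nsmul_eq_mul, hu y hy]
    have : ((u : ℤ) : ℝ) * ((u : ℤ) : ℝ) = 1 := by
      rcases Int.units_eq_one_or u with h' | h' <;> simp [h']
    linear_combination (-(#(outNbrs (spDilutedGraph d b) N y) : ℝ)) * this
  have h2 : ∑ y ∈ N, h y * spinAt y σ = ((u : ℤ) : ℝ) * ∑ y ∈ N, h y := by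
    rw [mul_sum]
    exact sum_congr rfl fun y hy => by rw [hu y hy]; ring
  rw [h1, h2]
  ring

end LemmaB

/-! ### The combination: erasing = flip∘shift on `I` then flip of `N` -/

section Erase

variable {b : ℕ}

/-- **Counting**: if every internal neighbour of `I` outside `I` lies in `N` (disjoint from `I`,
internal), the boundary pairs of `N` split into the boundary bonds of `I` (in the diluted graph) and
the boundary pairs of `N ∪ I`. [cite: VanenterFernandezSokal1993, App. B.5.3 (p. 236)] -/
theorem card_ffBdryPairs_eq_add {N I : Finset (Site d)} (hNI : Disjoint N I)
    (hNint : ∀ y ∈ N, ¬ IsSpImageSite d b y) (hIint : ∀ x ∈ I, ¬ IsSpImageSite d b x)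
    (hIN : ∀ x ∈ I, ∀ y ∉ I, (spDilutedGraph d b).Adj x y → y ∈ N) :
    #(ffBdryPairs d b N) = #(edgeBoundary (spDilutedGraph d b) I) + #(ffBdryPairs d b (N ∪ I)) := by
  classical
  rw [← card_filter_add_card_filter_not (s := ffBdryPairs d b N) (fun x => x.2 ∈ I)]
  congr 1
  · -- pairs into `I` are the boundary bonds of `I`
    refine card_bij (fun x _ => s(x.1, x.2)) (fun x hx => ?_) (fun x hx x' hx' hxx' => ?_) (fun e he => ?_)
    · obtain ⟨hx, hx2⟩ := mem_filter.1 hx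
      obtain ⟨h1, h2N, h3, h4⟩ := mem_ffBdryPairs.1 hx
      refine mem_edgeBoundary_iff.2 ⟨?_, ⟨x.2, hx2, Sym2.mem_mk_right _ _⟩,
        ⟨x.1, fun h' => h2N (Finset.disjoint_right.1 hNI h' |> fun h'' => absurd h1 h''), Sym2.mem_mk_left _ _⟩⟩
      rw [SimpleGraph.mem_edgeSet, spDilutedGraph_adj]
      exact ⟨h4, hNint _ h1, h3⟩
    · obtain ⟨hx, hx2⟩ := mem_filter.1 hx
      obtain ⟨hx', hx2'⟩ := mem_filter.1 hx'
      have h1 := (mem_ffBdryPairs.1 hx).1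
      have h1' := (mem_ffBdryPairs.1 hx').1
      rcases Sym2.eq_iff.1 hxx' with ⟨ha, hb'⟩ | ⟨ha, hb'⟩
      · exact Prod.ext ha hb'
      · exact absurd hx2' (Finset.disjoint_left.1 hNI (ha ▸ h1))
    · obtain ⟨heG, ⟨x, hx, hxe⟩, ⟨y, hy, hye⟩⟩ := mem_edgeBoundary_iff.1 he
      have hxy : x ≠ y := fun h' => hy (h' ▸ hx)
      have hexy : e = s(x, y) := (Sym2.mem_and_mem_iff hxy).1 ⟨hxe, hye⟩
      subst hexy
      have hadj : (spDilutedGraph d b).Adj x y := (SimpleGraph.mem_edgeSet _).1 heG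
      have hyN : y ∈ N := hIN x hx y hy hadj
      refine ⟨(y, x), mem_filter.2 ⟨mem_ffBdryPairs.2 ⟨hyN, ?_, hIint x hx, hadj.1.symm⟩, hx⟩, Sym2.eq_swap⟩
      exact Finset.disjoint_right.1 hNI hx
  · -- pairs avoiding `I` are the boundary pairs of `N ∪ I`
    congr 1
    ext x
    rw [mem_filter, mem_ffBdryPairs, mem_ffBdryPairs, mem_union, mem_union, not_or]
    constructor
    · rintro ⟨⟨h1, h2, h3, h4⟩, h5⟩
      exact ⟨Or.inl h1, ⟨h2, h5⟩, h3, h4⟩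
    · rintro ⟨h1 | h1, ⟨h2, h5⟩, h3, h4⟩
      · exact ⟨⟨h1, h2, h3, h4⟩, h5⟩
      · exact absurd (hIN _ h1 _ h5 ⟨h4, hIint _ h1, h3⟩) h2

/-- **The energy released by erasing (flip∘shift on `I`, then flip of `N`).** Under the band
hypotheses of Lemma A for `σ` on `I` (value `t` on the bands), with `σ ≡ t` on the set `N ⊇` all
internal neighbours of `I` outside `I`, `N` disjoint from `I`, and the flip-shifted configuration
`-t` on the internal neighbours of `N` outside `N`:
`ℋ(σ) - ℋ((flipShift I φ σ)^N) = 2·#ffBdryPairs(N ∪ I) - 2t·∑_{u ∈ N ∪ I} h_u` — the relative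
energy (B.71) of the `-t` island `N ∪ I` inserted into the ground state `t`.
[cite: VanenterFernandezSokal1993, App. B.5.3 eq. (B.71)] -/
theorem fieldHamiltonian_sub_erase (z : Site d) {Λ I N : Finset (Site d)} (hIΛ : I ⊆ Λ) (hNΛ : N ⊆ Λ)
    (hNI : Disjoint N I) (hNint : ∀ y ∈ N, ¬ IsSpImageSite d b y) (hIint : ∀ x ∈ I, ¬ IsSpImageSite d b x)
    (h : Site d → ℝ) (hALT : ∀ x ∈ I, h (spShift d b z x) = -h x) {σ : SpinConfig (Site d)} {t : ℤˣ}
    (hB1 : ∀ x ∈ I, spShift d b z x ∉ I → σ (spShift d b z x) = t)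
    (hB2 : ∀ x ∈ I, x ∉ I.image (spShift d b z) → σ x = t)
    (hBA : ∀ x ∈ I, ∀ y ∈ I, (spDilutedGraph d b).Adj x y →
      (x ∉ I.image (spShift d b z) ∨ y ∉ I.image (spShift d b z)) → σ x = σ y)
    (hBB : ∀ x ∈ I, ∀ y ∈ I, (spDilutedGraph d b).Adj x y →
      (spShift d b z x ∉ I ∨ spShift d b z y ∉ I) → σ (spShift d b z x) = σ (spShift d b z y))
    (hC : ∀ x ∈ I, ∀ y ∉ I, (spDilutedGraph d b).Adj x y → σ (spShift d b z x) = σ x ∧ σ y = σ x)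
    (hIN : ∀ x ∈ I, ∀ y ∉ I, (spDilutedGraph d b).Adj x y → y ∈ N)
    (hN : ∀ y ∈ N, σ y = t)
    (hout : ∀ y ∈ N, ∀ w ∉ N, (spDilutedGraph d b).Adj y w → flipShift I (spShift d b z) σ w = -t)
    (η : SpinConfig (Site d)) :
    fieldHamiltonian (spDilutedGraph d b) Λ h (.fixed η) σ -
        fieldHamiltonian (spDilutedGraph d b) Λ h (.fixed η) (flipOn N (flipShift I (spShift d b z) σ)) =
      2 * #(ffBdryPairs d b (N ∪ I)) - 2 * ((t : ℤ) : ℝ) * ∑ x ∈ N ∪ I, h x := by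
  have hA := fieldHamiltonian_flipShift_sub z hIΛ h hALT hB1 hB2 hBA hBB hC η
  have hN' : ∀ y ∈ N, flipShift I (spShift d b z) σ y = t := fun y hy => by
    rw [flipShift_of_notMem _ _ (Finset.disjoint_left.1 hNI hy), hN y hy]
  have hB := fieldHamiltonian_sub_flipOn_of_const hNΛ hNint h hN' hout η
  have hcount := card_ffBdryPairs_eq_add hNI hNint hIint hIN
  rw [sum_union hNI]
  have hcount' : (#(ffBdryPairs d b N) : ℝ) = #(edgeBoundary (spDilutedGraph d b) I) + #(ffBdryPairs d b (N ∪ I)) := by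
    exact_mod_cast hcount
  linear_combination hB - hA + 2 * hcount'

end Erase

/-! ### The Peierls condition bounds the released energy from below -/

section PeierlsBound

variable {b : ℕ}

/-- **The released energy is at least the contour area.** If the image fields on the island `M`,
signed by the ground-state value `t`, are the negatives of the fields of some image configuration
`ξ'` with isolated `-` spins (for `t = -1`: `ξ' = ζ` itself; for `t = +1`: the opposite-parity
pattern), then `2·#ffBdryPairs M - 2t·∑_{u ∈ M} h^ζ_u ≥ #ffBdryPairs M` by the tree's Peierls
condition `-∑_M h^{ξ'} ≤ #ffBdryPairs M / 2` (App. B.5.3, (B.71)–(B.77), constant `1/2`).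
[cite: VanenterFernandezSokal1993, App. B.5.3 eqs. (B.71)–(B.77)] -/
theorem card_ffBdryPairs_le_of_peierls (hd : 2 ≤ d) (hb : 2 ≤ b) {M : Finset (Site d)} {t : ℤˣ}
    {ζ ξ' : SpinConfig (Site d)} (hξ' : MinusIsolated d b ξ')
    (hrel : ∀ u ∈ M, ((t : ℤ) : ℝ) * imgField d b ζ u = -imgField d b ξ' u) :
    (#(ffBdryPairs d b M) : ℝ) ≤
      2 * #(ffBdryPairs d b M) - 2 * ((t : ℤ) : ℝ) * ∑ u ∈ M, imgField d b ζ u := by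
  have hP := sum_imgField_ge hd hb hξ' M
  have hsum : ((t : ℤ) : ℝ) * ∑ u ∈ M, imgField d b ζ u = -∑ u ∈ M, imgField d b ξ' u := by
    rw [mul_sum, ← sum_neg_distrib]
    exact sum_congr rfl hrel
  nlinarith [hsum, hP]

end PeierlsBound

end Literature.Barriers.CriticalPhenomena.NonGibbs

end
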